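import Summits.QuantumFields.YangMills.Theorems.BalabanUVNodesN07Thm1ScaledInterfaceInstance
import Summits.QuantumFields.YangMills.Theorems.BalabanUVNodesN20LCSAvgDomination
import Literature.MathematicalPhysics.QuantumFieldTheory.Balaban1983to89.T3DescentFibreTower

/-!
# BalabanUVNodes ∕ N07 ([Balaban1985Variational] Theorem 1, hypothesis (7) p. 278, in node00-def-P11's typed readings at the objects of record) —
# THE MIXED-PLAQUETTE OBSTRUCTION: print's (7) bounds the MIXED interface plaquettes `(∂V)(p′) = V(x,y)·V̄(y,z)·V(z,w)·V(w,x)` (coarse data ×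
# AVERAGED finer data); the typed data clause bounds only same-scale plaquettes of each `W n`, so it admits a flat, cross-scale-INCOMPATIBLE
# datum whose fibre meets NO regularity class — the existence conjunct fails and `VariationalThm1ScaledSep F N B₃ a₀ a₁` (with `…Scaled`,
# `…Class`) is FALSE FOR EVERY `B₃` (`0 < a₀`, `0 < a₁`; here `SU(2)`, or any `SU(N)` on which `dist1` takes the value `1`)

HEADLINE.  Work toward ONE FINITE-LATTICE STEP of Bałaban's programme — the typed RANGE of [15] Thm 1 at NODE 00's objects (cell `pub-ymgap`, Track A, DAG
node **N07** = [15] = [Balaban1985Variational]; seat `pub-ymgap-dag-n07-e`, generation 6, INTENT-18; `--supports stmt-QuantumFields-19909 --as helper`, the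
ROW-P11 negative lane).  THEOREMS ONLY (0 `def`, 0 `sorry`, 0 `instance`).  Companions: `…N07Thm1ScaledInterfaceInstance` (one-step index, cube lemmas);
dag-n21-c's `…K0VariationalThm1ScaledCorner(Sharp)` (p498335 ∕ p499903) is the DECLARER OF RECORD of the corner certificate (∀B₃ for `…Scaled`; floors
`B₃ ≥ L² ∕ 2L²` for `…Class ∕ …ScaledSep`) — a different mechanism, cited, not restated.  THIS file kills the FAITHFUL fact too, at every `B₃`.

PRINT ([15] p. 278, held text `paper:balaban1985-cmp102-variational-background` p0002): «(7) |(∂V)(p′) − 1| < ε₁ for p′ ∈ 𝔅 … This requires an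
explanation. For some j between 0 and k, p′ ∈ Λ_j. If p′ ⊂ Λ_j, i.e. all four vertices of p′ belong to Λ_j, then … (∂V)(p′) = V(∂p′). If p′ intersects the
boundary of Λ_j then some bonds b do not belong to Λ_j and we replace V_b by V̄_b in the above equality … (∂V)(p′) = V(x,y)V̄(y,z)V(z,w)V(w,x).»  The tree
QUOTES it (`B15TwoScaleT0` :30–32); node00-def-P11's data clause `∀ n ≤ k, PlaqSmallOn (plaqsOf (genSet s.Ω k n)) (δ n) (W n)` does not carry it.

THE INSTANCE.  `k = 1`; `Ω₁ = Λ₁ = D := cubeEnl P L 0 0` = the block of the coarse origin `0` (§4 of the companion; separation VACUOUS); datum `W 0 := 1`,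
`W 1 := (pure gauge) gaugeAct h 1` with `h ≡ 1` except `h(0 + e_{μ₀}) = g`, `W j := 1` (`j ≥ 2`): EVERY same-scale plaquette of the datum is EXACTLY `1`
(`dist1_plaqHol_gaugeAct_one`), so the typed data clause holds at every threshold; print's mixed plaquette at `p′ = ⟨0; μ₀, μ₁⟩` is
`W₁(0,μ₀)·1·1·W₁(0,μ₁)⁻¹ = g⁻¹` — EXCLUDED by (7) once `dist1 g ≥ ε₁`.  FIBRE ∩ CLASS = ∅ (§3, all letters in the tree): if `U` lies in the `ε₀`-class
(plaquettes touching `D` within `ε₀η₁²`) and `M_𝔅(U) = W` on `genSet s.Ω 1`, then (a) `U = 1` on every bond sourced off `D` (scale `0`, `Γ₀ = Dᶜ`), so EVERY fine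
plaquette is within `ε₀η₁²` (`dist1_plaqHol_le_of_agreeOn`); (b) `Ū(0,μ₀) = g⁻¹`, `Ū(0,μ₁) = 1` (scale `1`, `Γ₁ = D ∋ emb 0`; `Ū = avgFun expMeanLogSU U`,
`Node00.avOfRecord_avg`); (c) `Ū(0+e_{μ₀}, μ₁) = Ū(0+e_{μ₁}, μ₀) = 1` by LOCALITY (`BlockAveraging.avgFun_local`: the windows are blocks `≠ 0`, where `U ≡ 1`;
`T3DescentFibreTower.avgFun_one`); hence `Ū(∂p′) = g⁻¹`; (d) dag-n20-d's local crude Prop. 1 `N20LCSAvgDomination.dist1_plaqHol_avgFun_le_loc` bounds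
`dist1 (Ū(∂p′)) ≤ (L² + 6((d+2)L)²)·ε₀η₁² = (1 + 6(d+2)²)·ε₀ = 217·ε₀` (d = 4) once `(d+2)²ε₀∕4 < δ_{SU(N)}` — contradiction with `dist1 g⁻¹ = 1` for
`ε₀ < 1∕217` (`not_exists_mem_class_agreeOn`).  The refutations choose `ε₀ := min(a₀, δ_{SU}∕10, 1∕500)`, `δ_n := min(a₁, ε₀∕max(B₃,1))` (constant, comparable).

WHAT THIS SAYS ∕ DOES NOT SAY (HONEST FRAMING).  (i) All three typed [15]-facts are UNINHABITED at every `B₃` once `a₀, a₁ > 0`, through the EXISTENCE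
conjunct `.1` ALONE on an EMPTY fibre — the regularity conjunct `.2` (the only one any consumer reads: `plaqSmallOn_UbgMSOfRecord_of_thm1Scaled(Sep)`) is
untouched (vacuous here); a K0‴∕K0⁗ rung keyed on `h15 : VariationalThm1ScaledSep …` can never be fed; keying on `.2` alone, or adding print's mixed-plaquette
clause to the data hypothesis, are the located repairs (the definers', not done here).  (ii) NOTHING of [15] Theorem 1 AS PRINTED is refuted or asserted: print's (7)
EXCLUDES the datum.  (iii) Count-neutral; N07 ∕ K0‴ NOT discharged; one finite `𝕋⁴` programme at fixed `ε = L^{−K}` — NOT continuum ∕ ℝ⁴ ∕ OS ∕ mass gap ∕ Clay.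

DEPENDENCES (by name, nothing modified): companion 17a (`exists_seqOfRecord_one`, `RkOfRecord_zero_r`, `su2_dist1_surj`); dag-n20-d
`N20LCSAvgDomination.dist1_plaqHol_avgFun_le_loc`; `T3DescentFibreTower.avgFun_one ∕ expMeanLogSU_E_one`; `BlockAveraging.avgFun_local`; `T4ReTrLipUnitary.plaqHol_gaugeAct`;
`T4WilsonLinkAffine.shift_ne_self ∕ nontrivial_zmod_sitesPerDir`; node00-def-P11's three named facts and `cubeEnl_zero_eq`; `Node00.avOfRecord_avg`; r12 `B15DeterminingSets`.
-/

noncomputable section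

namespace Summit.QuantumFields.YangMills.BalabanUVNodes.N07Thm1MixedPlaquetteObstruction

open Literature.MathematicalPhysics.QuantumFieldTheory.Balaban1983to89
open Literature.MathematicalPhysics.QuantumFieldTheory.Balaban1983to89.T4Continuum (T4Family walkEnd Letter)
open Literature.MathematicalPhysics.QuantumFieldTheory.Balaban1983to89.Node00
open Literature.MathematicalPhysics.QuantumFieldTheory.Balaban1983to89.B15DeterminingSets
open Literature.MathematicalPhysics.QuantumFieldTheory.Balaban1983to89.T4AxialGaugeSmallField (castSite castSite_apply)
open Summit.QuantumFields.YangMills.BalabanUVNodes.N07Thm1ScaledInterfaceInstance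
open Summit.QuantumFields.YangMills.BalabanUVNodes.N20LCSAvgDomination (dist1_plaqHol_avgFun_le_loc)
open BlockAveraging (avgFun avgFun_local)
open ExpMeanLog (expMeanLogSU deltaSU deltaSU_pos)
open scoped Matrix.Norms.L2Operator
/-! ## §1  Lattice bookkeeping: coarse steps, and the cube of the coarse origin is its block -/

section Lattice

variable {P : Params} {j : ℕ}

/-- Two DIFFERENT steps from the same site land at different sites. [folklore] -/
theorem shift_ne_shift {y : Site P j} {μ ν : Fin P.d} (h : μ ≠ ν) : y.shift μ ≠ y.shift ν := by
  haveI := T4WilsonLinkAffine.nontrivial_zmod_sitesPerDir P j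
  intro hc
  have h1 := congr_fun hc μ
  have h2 : (y.shift μ) μ = y μ + 1 := by simp [Site.shift]
  have h3 : (y.shift ν) μ = y μ := by simp [Site.shift, h]
  rw [h2, h3] at h1
  exact one_ne_zero (by linear_combination h1 : (1 : ZMod (P.sitesPerDir j)) = 0)

/-- Two steps in different directions never return to the start. [folklore] -/
theorem shift_shift_ne_self {y : Site P j} {μ ν : Fin P.d} (h : μ ≠ ν) : (y.shift μ).shift ν ≠ y := by
  haveI := T4WilsonLinkAffine.nontrivial_zmod_sitesPerDir P j
  intro hc
  have h1 := congr_fun hc μ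
  have h2 : ((y.shift μ).shift ν) μ = y μ + 1 := by simp [Site.shift, Function.update_apply, h]
  rw [h2] at h1
  exact one_ne_zero (by linear_combination h1 : (1 : ZMod (P.sitesPerDir j)) = 0)

/-- **The `𝐃₁`-cube of index `0` and side `L` is the BLOCK of the coarse origin**: a fine site of `cubeEnl P L 0 0` has block label `0` (the tree's blocks are the
aligned boxes `[yL, yL + L − 1]^d`, `Setup.blockOf` = integer division by `L`; non-wrapping `L < 2L^{m+K}`). [cite: Balaban1987RG1, (0.1) p.252 (bookkeeping)] -/
theorem blockOf_eq_zero_of_mem_cubeEnl (hLn : P.L < P.sitesPerDir 0) {x : Site P 0} (hx : x ∈ cubeEnl P P.L 0 0) :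
    blockOf x = (0 : Site P 1) := by
  rw [cubeEnl_zero_eq] at hx
  obtain ⟨w, ⟨hlo, hhi⟩, rfl⟩ := hx
  funext κ
  have h0 : 0 ≤ w κ := by simpa [boxLo] using hlo κ
  have h1 : w κ ≤ (P.L : ℤ) - 1 := by simpa [boxHi] using hhi κ
  have hval : (((castSite w : Site P 0) κ).val : ℤ) = w κ := by
    rw [castSite_apply, ZMod.val_intCast]
    have hLn' : ((P.L : ℕ) : ℤ) < P.sitesPerDir 0 := by exact_mod_cast hLn
    exact Int.emod_eq_of_lt h0 (by linarith)
  have hlt : ((castSite w : Site P 0) κ).val < P.L := by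
    have : (((castSite w : Site P 0) κ).val : ℤ) < P.L := by rw [hval]; linarith
    exact_mod_cast this
  show (((((castSite w : Site P 0) κ).val / P.L : ℕ)) : ZMod (P.sitesPerDir (0 + 1))) = 0
  rw [Nat.div_eq_of_lt hlt, Nat.cast_zero]

/-- The centre `emb 0` of the origin block lies in the cube `cubeEnl P L 0 0` (`emb 0 = ((L−1)∕2, …, (L−1)∕2)`). [cite: Balaban1987RG1, (0.1) p.252 (bookkeeping)] -/
theorem emb_zero_mem_cubeEnl : emb (0 : Site P 1) ∈ cubeEnl P P.L 0 0 := by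
  rw [cubeEnl_zero_eq]
  have hL : 1 ≤ P.L := P.L_pos
  have hq0 : (0 : ℤ) ≤ (((P.L - 1) / 2 : ℕ) : ℤ) := by positivity
  have hq1 : (((P.L - 1) / 2 : ℕ) : ℤ) ≤ (P.L : ℤ) - 1 := by
    have : (P.L - 1) / 2 ≤ P.L - 1 := Nat.div_le_self _ _
    omega
  refine ⟨fun _ => (((P.L - 1) / 2 : ℕ) : ℤ), ⟨fun κ => ?_, fun κ => ?_⟩, ?_⟩
  · simp only [boxLo, Pi.zero_apply, mul_zero]
    exact hq0
  · simp only [boxHi, Pi.zero_apply, mul_zero, zero_add]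
    exact hq1
  · funext κ
    rw [castSite_apply]
    have h0 : ((0 : Site P 1) κ) = 0 := rfl
    show ((((P.L - 1) / 2 : ℕ) : ℤ) : ZMod (P.sitesPerDir 0)) =
      (((((0 : Site P 1) κ).val * P.L + (P.L - 1) / 2 : ℕ)) : ZMod (P.sitesPerDir 0))
    rw [h0, ZMod.val_zero, zero_mul, zero_add, Int.cast_natCast]

end Lattice

/-! ## §2  The datum: a coarse PURE GAUGE concentrated at one neighbour of the origin -/

section Datum

variable {P : Params} {G : Type*} [GaugeGroup G]

/-- A pure gauge is flat: every plaquette holonomy of `gaugeAct h 1` is `1`, so its `dist1` is `0`. [cite: Balaban1985Averaging, (11) p.19 (bookkeeping)] -/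
theorem dist1_plaqHol_gaugeAct_one {j : ℕ} (h : GaugeTransf P j G) (q : Plaq P j) :
    dist1 (GaugeField.plaqHol (GaugeField.gaugeAct h 1) q) = 0 := by
  rw [T4ReTrLipUnitary.plaqHol_gaugeAct]
  have h1 : GaugeField.plaqHol (1 : GaugeField P j G) q = 1 := by
    show (1 : G) * 1 * (1 : G)⁻¹ * (1 : G)⁻¹ = 1
    simp
  rw [h1, mul_one, mul_inv_cancel, GaugeGroup.dist1_one]

/-- The value of the pure gauge `gaugeAct (update 1 (y + e_μ) g) 1` on the bond `⟨y, μ⟩`: `g⁻¹`. [cite: Balaban1985Averaging, (8) p.19 (bookkeeping)] -/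
theorem gaugeAct_update_apply_self {j : ℕ} (y : Site P j) (μ : Fin P.d) (g : G) :
    GaugeField.gaugeAct (Function.update (fun _ : Site P j => (1 : G)) (y.shift μ) g) 1 ⟨y, μ⟩ = g⁻¹ := by
  show Function.update (fun _ : Site P j => (1 : G)) (y.shift μ) g y * 1 *
      (Function.update (fun _ : Site P j => (1 : G)) (y.shift μ) g (y.shift μ))⁻¹ = g⁻¹
  rw [Function.update_apply, if_neg (T4WilsonLinkAffine.shift_ne_self y μ).symm, Function.update_apply, if_pos rfl]
  simp

/-- … and on the bond `⟨y, ν⟩`, `ν ≠ μ`: `1`. [cite: Balaban1985Averaging, (8) p.19 (bookkeeping)] -/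
theorem gaugeAct_update_apply_other {j : ℕ} (y : Site P j) {μ ν : Fin P.d} (hμν : μ ≠ ν) (g : G) :
    GaugeField.gaugeAct (Function.update (fun _ : Site P j => (1 : G)) (y.shift μ) g) 1 ⟨y, ν⟩ = 1 := by
  show Function.update (fun _ : Site P j => (1 : G)) (y.shift μ) g y * 1 *
      (Function.update (fun _ : Site P j => (1 : G)) (y.shift μ) g (y.shift ν))⁻¹ = 1
  rw [Function.update_apply, if_neg (T4WilsonLinkAffine.shift_ne_self y μ).symm, Function.update_apply,
    if_neg (shift_ne_shift hμν.symm)]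
  simp

end Datum

/-! ## §3  ★ The pinned fibre: `U ≡ 1` off the block, averages `1` on every coarse bond whose window misses the block, and ★★ the empty fibre -/

section Fibre

variable (F : T4Family) {N : ℕ} [NeZero N]

/-- ★ **EVERY FINE PLAQUETTE IS `e`-SMALL** for a configuration that is `e`-small on the plaquettes touching `Ω₁ = D` and agrees with the datum `W 0 = 1` on the
bonds of `Γ₀ = Dᶜ`: a plaquette not touching `D` has its four bonds sourced off `D`, hence holonomy `1`. [cite: Balaban1988Convergent, (2.2) p.255, (2.10) p.256] -/
theorem dist1_plaqHol_le_of_agreeOn {K : ℕ} (Ω : ℕ → Set (Site (F.P K) 0)) {U : GaugeField (F.P K) 0 (SU N)} {W : MSField (F.P K) (SU N)}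
    (hW0 : W 0 = 1) (hA : AgreeOn (genSet Ω 1) (avgFamily (avOfRecord F N K) U) W) {e : ℝ} (he : 0 ≤ e)
    (hcl : PlaqSmallOn (B8Eq17ClassAkV1.plaqsOf (Ω 1)) e U) (q : Plaq (F.P K) 0) : dist1 (GaugeField.plaqHol U q) ≤ e := by
  by_cases hq : q ∈ B8Eq17ClassAkV1.plaqsOf (Ω 1)
  · exact (hcl q hq).le
  · have hb : ∀ b : PBond (F.P K) 0, b.src ∉ Ω 1 → U b = 1 := by
      intro b hb
      have hmem : b ∈ bondsOf (genSet Ω 1 0) := by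
        show b ∈ bondsOf (pts 0 (gammaRegion Ω 1 0))
        rw [gammaRegion_zero Ω zero_lt_one, pts_zero]
        exact Or.inl hb
      have := hA 0 b hmem
      rw [hW0] at this
      exact this
    simp only [B8Eq17ClassAkV1.mem_plaqsOf, not_or] at hq
    obtain ⟨h1, h2, h3, -⟩ := hq
    have hhol : GaugeField.plaqHol U q = 1 := by
      unfold GaugeField.plaqHol
      rw [hb ⟨q.src, q.μ⟩ h1, hb ⟨q.src.shift q.μ, q.ν⟩ h2, hb ⟨q.src.shift q.ν, q.μ⟩ h3, hb ⟨q.src, q.ν⟩ h1]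
      simp
    rw [hhol, GaugeGroup.dist1_one]
    exact he

/-- ★ **THE AVERAGE IS `1` ON A COARSE BOND WHOSE WINDOW MISSES THE BLOCK**: if `U = 1` on every fine bond sourced off `D = cubeEnl P L 0 0` (the block of the coarse
origin) and neither end of `c` is the origin, then `Ū(c) = 1` (locality of the (0.4) averaging + `avgFun 1 = 1`). [cite: Balaban1987RG1, (0.4) p.253; Balaban1985Averaging, p.19] -/
theorem avgFun_eq_one_of_window {K : ℕ} (hK : 0 + 1 ≤ (F.P K).m + (F.P K).K) (hLn : (F.P K).L < (F.P K).sitesPerDir 0)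
    {U : GaugeField (F.P K) 0 (SU N)} (hU : ∀ b : PBond (F.P K) 0, b.src ∉ cubeEnl (F.P K) (F.P K).L 0 0 → U b = 1)
    (c : PBond (F.P K) 1) (hs : c.src ≠ 0) (ht : c.tgt ≠ 0) : avgFun expMeanLogSU U c = 1 := by
  have hloc : avgFun expMeanLogSU U c = avgFun expMeanLogSU (1 : GaugeField (F.P K) 0 (SU N)) c := by
    refine avgFun_local _ hK U 1 c fun b hb => ?_
    have hb' : b.src ∉ cubeEnl (F.P K) (F.P K).L 0 0 := by
      intro hmem
      have h0 := blockOf_eq_zero_of_mem_cubeEnl hLn hmem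
      rcases hb with h | h
      · exact hs (h ▸ h0)
      · exact ht (h ▸ h0)
    exact hU b hb'
  rw [hloc, T3DescentFibreTower.avgFun_one _ T3DescentFibreTower.expMeanLogSU_E_one]
  rfl

/-- ★★ **THE FIBRE OF THE MIXED DATUM MEETS NO REGULARITY CLASS.**  On the torus `F.P K` with `s.Ω 1 = cubeEnl P L 0 0` (the block of the coarse origin), the
datum `W 0 = 1`, `W 1 = gaugeAct (update 1 (0 + e_{μ₀}) g) 1` (`dist1 g = 1`), and any `ε₀` with `(d+2)²ε₀∕4 < δ_{SU(N)}` and `(1 + 6(d+2)²)·ε₀ < 1`: NO configuration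
is `ε₀η₁²`-small on the plaquettes touching `s.Ω 1` and satisfies `M_𝔅(U) = W` on `genSet s.Ω 1` — by §3 (a)–(c) the coarse plaquette `Ū(∂⟨0; μ₀, μ₁⟩) = g⁻¹`, against
dag-n20-d's local Prop. 1 bound `≤ (L² + 6((d+2)L)²)·ε₀η₁²`. [cite: Balaban1985Variational, (7) p.278; Balaban1985Averaging, Prop. 1 (51) p.26; Balaban1987RG1, (0.4) p.253] -/
theorem not_exists_mem_class_agreeOn {K : ℕ} (Ω : ℕ → Set (Site (F.P K) 0)) (hΩ : Ω 1 = cubeEnl (F.P K) (F.P K).L 0 0)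
    {μ0 μ1 : Fin (F.P K).d} (hμ : μ0 < μ1) {g : SU N} (hg : dist1 g = 1) {W : MSField (F.P K) (SU N)} (hW0 : W 0 = 1)
    (hW1 : W 1 = GaugeField.gaugeAct (Function.update (fun _ : Site (F.P K) 1 => (1 : SU N)) ((0 : Site (F.P K) 1).shift μ0) g) 1)
    {ε₀ : ℝ} (hε : 0 ≤ ε₀) (hδ : (((F.P K).d + 2 : ℕ) : ℝ) ^ 2 / 4 * ε₀ < deltaSU (Fin N))
    (hsmall : (1 + 6 * (((F.P K).d + 2 : ℕ) : ℝ) ^ 2) * ε₀ < 1) :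
    ¬ ∃ U : GaugeField (F.P K) 0 (SU N), PlaqSmallOn (omegaPlaqs Ω 1) (ε₀ * (F.P K).eta 1 ^ 2) U ∧
        AgreeOn (genSet Ω 1) (avgFamily (avOfRecord F N K) U) W := by
  rintro ⟨U, hcl, hA⟩
  have hK : 0 + 1 ≤ (F.P K).m + (F.P K).K := by have := F.hm; simp only [T4Family.P_m, T4Family.P_K]; omega
  have hL1 : 1 ≤ F.L := by have := F.hL.2; omega
  have hLn : (F.P K).L < (F.P K).sitesPerDir 0 := by
    have h1 : F.L ≤ F.L ^ (F.m + K) := Nat.le_self_pow (by have := F.hm; omega) F.L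
    have h2 : (F.P K).sitesPerDir 0 = 2 * F.L ^ (F.m + K) := by simp [Params.sitesPerDir]
    rw [h2, T4Family.P_L]; omega
  have hLpos : (0 : ℝ) < (F.P K).L := by rw [T4Family.P_L]; exact_mod_cast hL1
  -- (a) every fine plaquette is `ε₀η₁²`-small
  set e : ℝ := ε₀ * (F.P K).eta 1 ^ 2 with he_def
  have he0 : 0 ≤ e := mul_nonneg hε (sq_nonneg _)
  rw [omegaPlaqs_of_ne_zero Ω one_ne_zero] at hcl
  have hall := dist1_plaqHol_le_of_agreeOn F Ω hW0 hA he0 hcl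
  have hoff : ∀ b : PBond (F.P K) 0, b.src ∉ cubeEnl (F.P K) (F.P K).L 0 0 → U b = 1 := by
    intro b hb
    have hmem : b ∈ bondsOf (genSet Ω 1 0) := by
      show b ∈ bondsOf (pts 0 (gammaRegion Ω 1 0))
      rw [gammaRegion_zero Ω zero_lt_one, pts_zero, hΩ]
      exact Or.inl hb
    have := hA 0 b hmem
    rw [hW0] at this
    exact this
  -- (b) the two data-pinned coarse bonds at the origin
  have hpts : ∀ μ : Fin (F.P K).d, (⟨0, μ⟩ : PBond (F.P K) 1) ∈ bondsOf (genSet Ω 1 1) := by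
    intro μ
    show (⟨0, μ⟩ : PBond (F.P K) 1) ∈ bondsOf (pts 1 (gammaRegion Ω 1 1))
    rw [gammaRegion_self, hΩ]
    exact Or.inl (show emb (0 : Site (F.P K) 1) ∈ cubeEnl (F.P K) (F.P K).L 0 0 from emb_zero_mem_cubeEnl)
  have havg : avgFamily (avOfRecord F N K) U 1 = avgFun expMeanLogSU U := by
    show (avOfRecord F N K 0).avg U = _
    rw [avOfRecord_avg]
  have hb0 : avgFun expMeanLogSU U ⟨0, μ0⟩ = g⁻¹ := by
    have := hA 1 ⟨0, μ0⟩ (hpts μ0)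
    rw [havg, hW1, gaugeAct_update_apply_self] at this
    exact this
  have hb1 : avgFun expMeanLogSU U ⟨0, μ1⟩ = 1 := by
    have := hA 1 ⟨0, μ1⟩ (hpts μ1)
    rw [havg, hW1, gaugeAct_update_apply_other 0 (ne_of_lt hμ) g] at this
    exact this
  -- (c) the two window-pinned coarse bonds
  have hne : μ0 ≠ μ1 := ne_of_lt hμ
  have hc2 : avgFun expMeanLogSU U ⟨(0 : Site (F.P K) 1).shift μ0, μ1⟩ = 1 :=
    avgFun_eq_one_of_window F hK hLn hoff _ (T4WilsonLinkAffine.shift_ne_self 0 μ0) (shift_shift_ne_self hne)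
  have hc3 : avgFun expMeanLogSU U ⟨(0 : Site (F.P K) 1).shift μ1, μ0⟩ = 1 :=
    avgFun_eq_one_of_window F hK hLn hoff _ (T4WilsonLinkAffine.shift_ne_self 0 μ1) (shift_shift_ne_self hne.symm)
  -- hence the coarse plaquette is `g⁻¹`
  have hplaq : GaugeField.plaqHol (avgFun expMeanLogSU U) ⟨0, μ0, μ1, hμ⟩ = g⁻¹ := by
    show avgFun expMeanLogSU U ⟨0, μ0⟩ * avgFun expMeanLogSU U ⟨(0 : Site (F.P K) 1).shift μ0, μ1⟩ *
        (avgFun expMeanLogSU U ⟨(0 : Site (F.P K) 1).shift μ1, μ0⟩)⁻¹ * (avgFun expMeanLogSU U ⟨0, μ1⟩)⁻¹ = g⁻¹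
    rw [hb0, hb1, hc2, hc3]
    simp
  -- (d) dag-n20-d's local crude Prop. 1
  have hδ' : ((((F.P K).d + 2) * (F.P K).L : ℕ) : ℝ) ^ 2 / 4 * e < deltaSU (Fin N) := by
    have : ((((F.P K).d + 2) * (F.P K).L : ℕ) : ℝ) ^ 2 / 4 * e = (((F.P K).d + 2 : ℕ) : ℝ) ^ 2 / 4 * ε₀ := by
      rw [he_def, Params.eta]; push_cast; field_simp
    rw [this]; exact hδ
  have hN20 := dist1_plaqHol_avgFun_le_loc (n := Fin N) hK he0 (U := U) ⟨0, μ0, μ1, hμ⟩ (fun v _ a b h => hall _) hδ'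
  have hval : (((F.P K).L : ℝ) ^ 2 + 6 * ((((F.P K).d + 2) * (F.P K).L : ℕ) : ℝ) ^ 2) * e =
      (1 + 6 * (((F.P K).d + 2 : ℕ) : ℝ) ^ 2) * ε₀ := by
    rw [he_def, Params.eta]; push_cast; field_simp
  rw [hplaq, GaugeGroup.dist1_inv, hg, hval] at hN20
  linarith

end Fibre

/-! ## §4  ★★★ The refutations: every `B₃` -/

section Refutations

variable (F : T4Family) {N : ℕ} [NeZero N]

/-- ★★ **THE INSTANCE OF RECORD** (torus `F.P 1`, `k = 1`): for every `B₃` and all `a₀, a₁ > 0`, a (vacuously) separated one-step index `s`, a CONSTANT threshold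
`δ` with `0 < δ ≤ a₁`, `B₃δ ≤ ε₀ ≤ a₀`, and the mixed datum `W` meeting the typed data clause at `δ`, such that NO minimiser of (2.12) over the `ε₀`-class with
datum `W` exists (indeed the class ∩ fibre is empty, §3).  Needs one element of `SU(N)` at `dist1 = 1`. [cite: Balaban1985Variational, Thm 1 (7)–(8) pp.278–279] -/
theorem exists_mixed_instance (hG : ∃ g : SU N, dist1 g = 1) (B₃ : ℝ) {a₀ a₁ : ℝ} (ha₀ : 0 < a₀) (ha₁ : 0 < a₁) :
    ∃ (ν : Stage7Numerics) (M : ℕ) (g : ℕ → ℝ) (s : SeqOfRecord F ν M g 1 1) (ε₀ δ : ℝ) (W : MSField (F.P 1) (SU N)),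
      Sect2.SeqSeparated ν.M₁ s ∧ 0 < δ ∧ δ ≤ a₁ ∧ B₃ * δ ≤ ε₀ ∧ ε₀ ≤ a₀ ∧
      (∀ n, n ≤ 1 → PlaqSmallOn (B8Eq17ClassAkV1.plaqsOf (genSet s.Ω 1 n)) δ (W n)) ∧
      ¬ ∃ U₀, IsMinimizer (avOfRecord F N 1) {U | ∀ n, n ≤ 1 → PlaqSmallOn (omegaPlaqs s.Ω n) (ε₀ * (F.P 1).eta n ^ 2) U}
            (genSet s.Ω 1) W U₀ := by
  obtain ⟨g, hg⟩ := hG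
  -- the numerics of the one-step index (companion 17a): `r = 0`, `M = 1`, `g ≡ 1`, side `L`
  let ν : Stage7Numerics := ⟨1, 1, 0, 0, 0, 0, 0, 0⟩
  have hside : dCubeSide (F.P 1).L 1 (RkOfRecord (F.P 1).L ν.r ((fun _ : ℕ => (1 : ℝ)) 1)) 1 = (F.P 1).L := by
    simp [dCubeSide, RkOfRecord_zero_r, ν]
  have hL1 : 1 ≤ (F.P 1).L := by rw [T4Family.P_L]; have := F.hL.2; omega
  obtain ⟨s, hsΩ⟩ := exists_seqOfRecord_one F ν 1 (fun _ => (1 : ℝ)) 1 (by rw [hside]; exact hL1)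
  rw [hside] at hsΩ
  -- directions and the datum
  have hd : (F.P 1).d = 4 := T4Family.P_d F 1
  let μ0 : Fin (F.P 1).d := ⟨0, by omega⟩
  let μ1 : Fin (F.P 1).d := ⟨1, by omega⟩
  have hμ : μ0 < μ1 := Fin.mk_lt_mk.mpr zero_lt_one
  let W₁ : GaugeField (F.P 1) 1 (SU N) :=
    GaugeField.gaugeAct (Function.update (fun _ : Site (F.P 1) 1 => (1 : SU N)) ((0 : Site (F.P 1) 1).shift μ0) g) 1
  let W : MSField (F.P 1) (SU N) := fun j => match j with
    | 0 => 1
    | 1 => W₁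
    | _ + 2 => 1
  -- thresholds
  have hδSU := deltaSU_pos (n := Fin N)
  set ε₀ : ℝ := min a₀ (min (deltaSU (Fin N) / 10) (1 / 500)) with hε₀
  have hε₀pos : 0 < ε₀ := lt_min ha₀ (lt_min (by linarith) (by norm_num))
  have hε₀a₀ : ε₀ ≤ a₀ := min_le_left _ _
  have hε₀δ : ε₀ ≤ deltaSU (Fin N) / 10 := (min_le_right _ _).trans (min_le_left _ _)
  have hε₀s : ε₀ ≤ 1 / 500 := (min_le_right _ _).trans (min_le_right _ _)
  set b : ℝ := max B₃ 1 with hb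
  have hb1 : 1 ≤ b := le_max_right _ _
  have hbB : B₃ ≤ b := le_max_left _ _
  have hb0 : 0 < b := by linarith
  set δc : ℝ := min a₁ (ε₀ / b) with hδc
  have hδcpos : 0 < δc := lt_min ha₁ (div_pos hε₀pos hb0)
  have hBδ : B₃ * δc ≤ ε₀ :=
    calc B₃ * δc ≤ b * δc := mul_le_mul_of_nonneg_right hbB hδcpos.le
      _ ≤ b * (ε₀ / b) := mul_le_mul_of_nonneg_left (min_le_right _ _) hb0.le
      _ = ε₀ := by field_simp
  have hW : ∀ n, n ≤ 1 → PlaqSmallOn (B8Eq17ClassAkV1.plaqsOf (genSet s.Ω 1 n)) δc (W n) := by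
    intro n hn q _
    rcases Nat.le_one_iff_eq_zero_or_eq_one.mp hn with rfl | rfl
    · show dist1 (GaugeField.plaqHol (1 : GaugeField (F.P 1) 0 (SU N)) q) < δc
      have : GaugeField.plaqHol (1 : GaugeField (F.P 1) 0 (SU N)) q = 1 := by
        show (1 : SU N) * 1 * (1 : SU N)⁻¹ * (1 : SU N)⁻¹ = 1
        simp
      rw [this, GaugeGroup.dist1_one]
      exact hδcpos
    · show dist1 (GaugeField.plaqHol W₁ q) < δc
      rw [dist1_plaqHol_gaugeAct_one]
      exact hδcpos
  have hd2 : (((F.P 1).d + 2 : ℕ) : ℝ) = 6 := by rw [hd]; norm_num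
  refine ⟨ν, 1, fun _ => 1, s, ε₀, δc, W, fun n h1 hn => by omega, hδcpos, min_le_left _ _, hBδ, hε₀a₀, hW, ?_⟩
  rintro ⟨U₀, hU₀⟩
  refine not_exists_mem_class_agreeOn F s.Ω hsΩ hμ hg (W := W) rfl rfl hε₀pos.le ?_ ?_ ⟨U₀, hU₀.1 1 le_rfl, hU₀.2.1⟩
  · rw [hd2]; linarith
  · rw [hd2]; linarith

/-- ★★★ **THE FAITHFUL (SEPARATED, COMPARABLE) TYPED READING IS UNINHABITED AT EVERY `B₃`**: for all `a₀, a₁ > 0` and every `B₃`,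
`¬ VariationalThm1ScaledSep F N B₃ a₀ a₁` on any `SU(N)` holding an element at `dist1 = 1` — the existence conjunct fails at the mixed datum (print's (7)
excludes it; the typed data clause does not). [cite: Balaban1985Variational, Thm 1 (7)–(8) pp.278–279; Balaban1988Convergent, (2.10)–(2.12) p.256] -/
theorem not_variationalThm1ScaledSep_of_dist1 (hG : ∃ g : SU N, dist1 g = 1) {B₃ a₀ a₁ : ℝ} (ha₀ : 0 < a₀) (ha₁ : 0 < a₁) :
    ¬ VariationalThm1ScaledSep F N B₃ a₀ a₁ := by
  intro h15
  obtain ⟨ν, M, g, s, ε₀, δ, W, hsep, hδ0, hδ1, hB, hε₀, hW, hno⟩ := exists_mixed_instance F hG B₃ ha₀ ha₁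
  exact hno (h15 ν M g 1 1 s hsep ε₀ (fun _ => δ) (fun _ _ => ⟨hδ0, hδ1, hB⟩) (fun _ _ => by linarith) hε₀ W hW).1

/-- ★★★ The unguarded per-scale reading is uninhabited at every `B₃` (also by dag-n21-c's corner certificate p498335 — the record; here as a corollary of the
faithful case through node00-def-P11's `VariationalThm1Scaled.toScaledSep`). [cite: Balaban1985Variational, Thm 1 (7)–(8) pp.278–279] -/
theorem not_variationalThm1Scaled_of_dist1 (hG : ∃ g : SU N, dist1 g = 1) {B₃ a₀ a₁ : ℝ} (ha₀ : 0 < a₀) (ha₁ : 0 < a₁) :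
    ¬ VariationalThm1Scaled F N B₃ a₀ a₁ :=
  fun h => not_variationalThm1ScaledSep_of_dist1 F hG ha₀ ha₁ h.toScaledSep

/-- ★★★ The printed-uniform typed reading is uninhabited at every `B₃` (same datum, uniform threshold `δ`). [cite: Balaban1985Variational, Thm 1 (7)–(8) pp.278–279] -/
theorem not_variationalThm1Class_of_dist1 (hG : ∃ g : SU N, dist1 g = 1) {B₃ a₀ a₁ : ℝ} (ha₀ : 0 < a₀) (ha₁ : 0 < a₁) :
    ¬ VariationalThm1Class F N B₃ a₀ a₁ := by
  intro h15
  obtain ⟨ν, M, g, s, ε₀, δ, W, -, hδ0, hδ1, hB, hε₀, hW, hno⟩ := exists_mixed_instance F hG B₃ ha₀ ha₁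
  exact hno (h15 ν M g 1 1 s ε₀ δ hδ0 hδ1 hB hε₀ W hW).1

/-- `SU(2)` has an element at `dist1 = 1` (companion 17a `su2_dist1_surj`). [folklore] -/
theorem exists_su2_dist1_eq_one : ∃ g : SU 2, dist1 g = 1 := su2_dist1_surj 1 zero_le_one one_le_two

/-- ★★★ **`SU(2)`: `¬ VariationalThm1ScaledSep F 2 B₃ a₀ a₁` FOR EVERY `B₃`** (`0 < a₀`, `0 < a₁`) — a K0‴∕K0⁗ rung keyed on this named fact can never be fed.
[cite: Balaban1985Variational, Thm 1 (7)–(8) pp.278–279] -/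
theorem not_variationalThm1ScaledSep {B₃ a₀ a₁ : ℝ} (ha₀ : 0 < a₀) (ha₁ : 0 < a₁) : ¬ VariationalThm1ScaledSep F 2 B₃ a₀ a₁ :=
  not_variationalThm1ScaledSep_of_dist1 F exists_su2_dist1_eq_one ha₀ ha₁

/-- ★★★ `SU(2)`: `¬ VariationalThm1Class F 2 B₃ a₀ a₁` for every `B₃`. [cite: Balaban1985Variational, Thm 1 (7)–(8) pp.278–279] -/
theorem not_variationalThm1Class {B₃ a₀ a₁ : ℝ} (ha₀ : 0 < a₀) (ha₁ : 0 < a₁) : ¬ VariationalThm1Class F 2 B₃ a₀ a₁ :=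
  not_variationalThm1Class_of_dist1 F exists_su2_dist1_eq_one ha₀ ha₁

/-- Contrapositive packaging for the plan's key: if the faithful named fact holds at `SU(2)` for some `(B₃, a₀, a₁)` then `a₀ ≤ 0 ∨ a₁ ≤ 0` (its own threshold
hypotheses are then unsatisfiable — the fact is VACUOUS). [cite: Balaban1985Variational, Thm 1 (7)–(8) pp.278–279 (bookkeeping)] -/
theorem variationalThm1ScaledSep_only_degenerate {B₃ a₀ a₁ : ℝ} (h : VariationalThm1ScaledSep F 2 B₃ a₀ a₁) : a₀ ≤ 0 ∨ a₁ ≤ 0 := by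
  by_contra hc
  simp only [not_or, not_le] at hc
  exact not_variationalThm1ScaledSep F hc.1 hc.2 h

end Refutations

end Summit.QuantumFields.YangMills.BalabanUVNodes.N07Thm1MixedPlaquetteObstruction

end
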